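import Literature.MathematicalPhysics.QuantumFieldTheory.BalabanImbrieJaffe1984to88.BIJ88MultiscaleDecay223

/-!
# `BalabanImbrieJaffe1984to88.BIJ88HolderDecay213` — T. Bałaban, J. Imbrie, A. Jaffe, *Effective action and cluster properties of the
abelian Higgs model*, Commun. Math. Phys. **114** (1988) 257–315 [BalabanImbrieJaffe1988]: p. 261, the SECOND CLAUSE of (2.13) —
*"|(𝒟_{k,loc}f)(b)| ≦ ce^{−c dist(suppt f,b)}‖f‖_∞, (2.13) and similarly for derivatives of 𝒟_{k,loc} and Hölder derivatives of order less
than 2"* — the multiscale mechanism for DIFFERENCES of the hierarchical sum (2.12): lattice derivatives and Hölder quotients, with the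
interpolated scaling factor that decides «order less than 2»

statement-level skeleton of published theorems with citation tags; proofs where landed; nothing here is a claim about the Yang–Mills mass gap

PDF held: `paper:balaban1988-cmp114-bij-abelian-higgs-effective-action` (journal page = PDF page + 256); p. 261 [PDF 5] (text layer re-read
this session; render of the page in the gen-4 seat folder `renders/bij88-p005.png`).

WHAT IS REPRODUCED.  SKELETON row **C2.Eq2.13** (owner r18 `ROWS-C2.md`: *"BOUND |(𝒟_{k,loc}f)(b)| ≦ ce^{−c dist(suppt f,b)}‖f‖_∞ (+ derivatives,
Hölder < 2)"*; typed `BIJ88Sect2Statements.OpDecay`, the function clause PROVED as a hence-step by `BIJ88MultiscaleDecay223.opDecay213_typed`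
(p249538) and on the tori by `BIJ88MultiscaleDecay223Torus` (p250796)) — here the «derivatives … and Hölder derivatives of order less than 2»
clause, which r18's typing leaves as prose.  Cell `lit-balaban`, HOME `run/shared/lean/pub/lit-balaban/`; Phase-2 seat p08 gen 5 = unit
`lit-balaban-p08`; referee ref-5; TAKING line HOME/STATUS.md 2026-08-21T06:02Z.
p. 261, verbatim: *"𝒟_{k,loc} = Σ_{j=0}^{k−1} H^{L^jη}_{j,loc}C^{(j),L^jη}_{loc}H^{*L^j}_{j,loc} ≡ Σ_{j=0}^{k−1} G^{(j),η}_{loc}. (2.12) Superscripts L^jη, η,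
etc. indicate the lattice spacing for operators rescaled to nonstandard lattices. This propagator derives its regularity and decay from that of
C^{(j)}_{loc} and H_{k,loc}. Thus |(𝒟_{k,loc}f)(b)| ≦ ce^{−c dist(suppt f,b)}‖f‖_∞, (2.13) and similarly for derivatives of 𝒟_{k,loc} and Hölder
derivatives of order less than 2."*; and the bracketed mechanism sentence printed with (2.16) on the same page: *"[The rapid decay of the
terms with small j compensates for the scaling factors (L^jη)^{−1}.]"*.

THE READING (kind «hence-step, explicit constants»; exactly parallel to the accepted function clause).  As in `BIJ88MultiscaleDecay223` §5
the kernel of 𝒟_{k,loc} (or of one of its lattice derivatives), rescaled to step k, is the sum over scales `n = k − 1 − j` of terms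
`D_n(b,a)` (output index b, input index a) obeying PER-SCALE bounds of printed shape — *"The kernels of all these operators have an
exponential decay on their respective length scales"* (p. 262): a sup bound `|D_n(b,a)| ≤ AΛⁿe^{−δLⁿdist(a,b)}` and, for the difference in
the output variable, a Lipschitz bound with ONE MORE inverse length of the n-th scale, `|D_n(b,a) − D_n(b′,a)| ≤ AΛⁿMⁿ·sep(b,b′)·
e^{−δLⁿmin{dist(a,b),dist(a,b′)}}` (print: each derivative of a scale-j kernel costs the scaling factor `(L^jη)^{−1} = Lⁿ` in step-k units,
so `M = L`; the sup factor `Λ` of the family is `< 1` for 𝒟_{k,loc} itself — the regime of (2.13) — and gains one factor `L` per derivative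
already taken).  These per-scale estimates are the displayed HYPOTHESES here, as in the function clause; they are [I] (7.2.2)–(7.2.3) /
(2.5)-shape inputs and are not re-derived.
WHAT IS PROVED (0 `sorry`, axioms {propext, Classical.choice, Quot.sound}; theorems only):
* §1 `le_rpow_interpolate`, **`abs_sub_le_holder`** — the discrete interpolation behind «Hölder derivatives»: a sup bound `B·E` at both
  points and a Lipschitz bound `B·M·sep·E` give the Hölder-θ bound `2^{1−θ}·B·M^θ·sep^θ·E` for every `0 ≤ θ ≤ 1`;
* §2 **`holderKernel_le`** — THE MECHANISM: the per-scale bounds above give, for every number of scales `N`, every pair of output points and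
  every input point, `|Σ_{n<N}(D_n(b,a) − D_n(b′,a))| ≤ (2^{1−θ}A/(1 − ΛM^θ))·sep(b,b′)^θ·e^{−δ min{dist(a,b),dist(a,b′)}}` PROVIDED THE
  INTERPOLATED SCALING FACTOR `ΛM^θ` IS `< 1` — uniformly in k; `holderMajorant_ge` — at `ΛM^θ ≥ 1` the per-scale majorants alone sum to
  `≥ N·(const)`, no bound uniform in the number of scales comes out of them (with print's factors `Λ = L^{−1}` for the first-derivative
  kernels and `M = L`: `ΛM^θ = L^{θ−1} < 1 ⟺ θ < 1 ⟺ total order 1 + θ < 2` — «of order less than 2»);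
* §3 **`holderOpDecay213`** — the OPERATOR form in r18's (2.13) vocabulary (`applyK`, `suppDist`, `supNorm`): with the row sums
  `Σ_a e^{−(δ/2)dist(a,b)} ≤ S` (p02's kernel ⟹ operator step `BIJ88OpDecay230Proof.abs_applyK_le_of_kernel` on the pair carrier `β × β`),
  `|(𝒟f)(b) − (𝒟f)(b′)| ≤ (2^{1−θ}A/(1−ΛM^θ))·2S·sep(b,b′)^θ·e^{−(δ/2)dist(suppt f,{b,b′})}‖f‖_∞` for all `b, b′`, all `f`, all `N`; the endpoints
  `differenceOpDecay213` (θ = 1: the lattice derivative = difference quotient at separation one spacing, condition `ΛM < 1`) and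
  `opDecay213_scaled` (a family whose sup factors carry extra powers `Mⁿ`, e.g. the derivative kernels themselves: r18's one-letter `OpDecay`
  again when `ΛM < 1`, by `opDecay213_typed`).
§4 (v1.1, append-only): the companion sentence *"𝒟_{k,loc}(b₁,b₂) = 0 for dist(b₁,b₂) ≧ ½r(e_k)"* ACROSS SCALES — the displayed
hypothesis of `BIJ88MultiscaleDecay223.vanishes213_typed` for the lower scales DISCHARGED from (2.2)–(2.3): `log_inv_eK_eq_add`
(`log e_j⁻¹ = log e_k⁻¹ + (k−j)((4−d)/2)log L`), **`rLen_scale_le`** (`r(e_j) ≤ L^{k−j}r(e_k)` for `j ≤ k` once `log e_k⁻¹ ≥ r(4−d)/2`, i.e. e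
small), `vanishes_mono`, **`vanishes213_of_scales`** (terms of scale `k − n` with their own printed range `L^{−n}·½r(e_{k−n})` in step-k units
⟹ `Vanishes dist 𝒟_{k,loc} (r(e_k)/2)`).
HONEST SCOPE.  Hence-steps only: the per-scale sup/Lipschitz estimates of the terms of (2.12) and the identification of print's factors
(`M = L` per derivative, `Λ < 1` two powers of `L` to spare for 𝒟_{k,loc} in d ≤ 3) are the READING stated above, displayed as hypotheses,
not derived; distances abstract (`dist ≥ 0` from inputs to outputs, `sep ≥ 0` between outputs); the Hölder quotient is taken in the output
variable of the kernel (print's «Hölder derivatives» of the bond function `𝒟_{k,loc}f`); r18 types no predicate for this clause, so the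
results are stated in explicit form (no new `def`).  Nothing on d = 4 or the continuum; NOT summit progress.
-/

namespace Literature.MathematicalPhysics.QuantumFieldTheory.BalabanImbrieJaffe1984to88.BIJ88HolderDecay213

open Finset BIJ88Sect2Statements BIJ88OpDecay230Proof BIJ88MultiscaleDecay223

noncomputable section

variable {α β : Type*}

/-! ## §1  Discrete interpolation: sup bound and Lipschitz bound ⟹ Hölder bound -/

/-- `x^{1−θ}·x^θ = x` for `x ≥ 0` (real powers; `(1 − θ) + θ = 1 ≠ 0` so no positivity of the base is needed).
[cite: BalabanImbrieJaffe1988, (2.13) p.261] -/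
private theorem rpow_split {x : ℝ} (θ : ℝ) (hx : 0 ≤ x) : x ^ (1 - θ) * x ^ θ = x := by
  have hne : (1 - θ) + θ ≠ 0 := by rw [show (1 - θ) + θ = (1 : ℝ) by ring]; exact one_ne_zero
  rw [← Real.rpow_add' hx hne, show (1 - θ) + θ = (1 : ℝ) by ring, Real.rpow_one]

/-- **min ≤ geometric mean**, the form used for Hölder quotients: `0 ≤ t ≤ P`, `t ≤ Q`, `0 ≤ θ ≤ 1` ⟹ `t ≤ P^{1−θ}Q^θ`.
[cite: BalabanImbrieJaffe1988, (2.13) p.261] -/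
theorem le_rpow_interpolate {t P Q θ : ℝ} (ht : 0 ≤ t) (hP : t ≤ P) (hQ : t ≤ Q) (hθ0 : 0 ≤ θ) (hθ1 : θ ≤ 1) :
    t ≤ P ^ (1 - θ) * Q ^ θ := by
  have hP0 : 0 ≤ P := ht.trans hP
  have h1 : t ^ (1 - θ) ≤ P ^ (1 - θ) := Real.rpow_le_rpow ht hP (by linarith)
  have h2 : t ^ θ ≤ Q ^ θ := Real.rpow_le_rpow ht hQ hθ0
  calc t = t ^ (1 - θ) * t ^ θ := (rpow_split θ ht).symm
    _ ≤ P ^ (1 - θ) * Q ^ θ := mul_le_mul h1 h2 (Real.rpow_nonneg ht _) (Real.rpow_nonneg hP0 _)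

/-- **The interpolation behind «Hölder derivatives».**  Two values with the common sup bound `|x|, |y| ≤ B·E` and the Lipschitz bound
`|x − y| ≤ B·M·sep·E` (M = the inverse length of the scale, sep = the separation of the two output points, E = the common decay factor)
satisfy, for every `0 ≤ θ ≤ 1`, the Hölder-θ bound `|x − y| ≤ 2^{1−θ}·B·M^θ·sep^θ·E`. [cite: BalabanImbrieJaffe1988, (2.13) p.261] -/
theorem abs_sub_le_holder {x y B M sep E θ : ℝ} (hB : 0 ≤ B) (hM : 0 ≤ M) (hsep : 0 ≤ sep) (hE : 0 ≤ E) (hθ0 : 0 ≤ θ)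
    (hθ1 : θ ≤ 1) (hx : |x| ≤ B * E) (hy : |y| ≤ B * E) (hlip : |x - y| ≤ B * M * sep * E) :
    |x - y| ≤ 2 ^ (1 - θ) * B * M ^ θ * sep ^ θ * E := by
  have hsum : |x - y| ≤ 2 * B * E := by
    calc |x - y| ≤ |x| + |y| := abs_sub x y
      _ ≤ B * E + B * E := add_le_add hx hy
      _ = 2 * B * E := by ring
  have h := le_rpow_interpolate (abs_nonneg _) hsum hlip hθ0 hθ1
  have h2 : (0 : ℝ) ≤ 2 := by norm_num
  have h2B : (0 : ℝ) ≤ 2 * B := by positivity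
  have hBM : 0 ≤ B * M := by positivity
  have hBMs : 0 ≤ B * M * sep := by positivity
  have halg : (2 * B * E) ^ (1 - θ) * (B * M * sep * E) ^ θ = 2 ^ (1 - θ) * B * M ^ θ * sep ^ θ * E := by
    rw [Real.mul_rpow h2B hE, Real.mul_rpow h2 hB, Real.mul_rpow hBMs hE, Real.mul_rpow hBM hsep, Real.mul_rpow hB hM]
    calc 2 ^ (1 - θ) * B ^ (1 - θ) * E ^ (1 - θ) * (B ^ θ * M ^ θ * sep ^ θ * E ^ θ)
        = 2 ^ (1 - θ) * (B ^ (1 - θ) * B ^ θ) * M ^ θ * sep ^ θ * (E ^ (1 - θ) * E ^ θ) := by ring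
      _ = 2 ^ (1 - θ) * B * M ^ θ * sep ^ θ * E := by rw [rpow_split θ hB, rpow_split θ hE]
  rw [halg] at h
  exact h

/-! ## §2  The multiscale mechanism for differences: the interpolated scaling factor `ΛM^θ` -/

/-- **THE MECHANISM FOR DERIVATIVES AND HÖLDER QUOTIENTS OF THE HIERARCHICAL SUM.**  Terms `D_n(b,a)` (`n < N` scales; output b, input a)
with per-scale sup bounds `|D_n(b,a)| ≤ AΛⁿe^{−δLⁿdist(a,b)}` and per-scale Lipschitz bounds in the output variable
`|D_n(b,a) − D_n(b′,a)| ≤ AΛⁿMⁿ·sep(b,b′)·e^{−δLⁿmin{dist(a,b),dist(a,b′)}}` (`L ≥ 1`, `Λ, M, A, δ, dist, sep ≥ 0`): for every `0 ≤ θ ≤ 1` with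
**`ΛM^θ < 1`**, every `N`, `b`, `b′`, `a`:
`|Σ_{n<N}(D_n(b,a) − D_n(b′,a))| ≤ (2^{1−θ}A/(1 − ΛM^θ))·sep(b,b′)^θ·e^{−δ min{dist(a,b),dist(a,b′)}}` — uniformly in the number of scales.  With
print's factors (`M = L`: *"the scaling factors (L^jη)^{−1}"*; `Λ = L^{−1}` for the first-derivative kernels of 𝒟_{k,loc}) the condition reads
`L^{θ−1} < 1`, i.e. total order `1 + θ < 2`. [cite: BalabanImbrieJaffe1988, (2.13) p.261] -/
theorem holderKernel_le {D : ℕ → β → α → ℝ} {dist : α → β → ℝ} {sep : β → β → ℝ} {A Λ M L δ θ : ℝ}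
    (hL : 1 ≤ L) (hΛ : 0 ≤ Λ) (hM : 0 ≤ M) (hA : 0 ≤ A) (hδ : 0 ≤ δ) (hθ0 : 0 ≤ θ) (hθ1 : θ ≤ 1)
    (hr : Λ * M ^ θ < 1) (hd : ∀ a b, 0 ≤ dist a b) (hsep : ∀ b b', 0 ≤ sep b b')
    (hsup : ∀ n b a, |D n b a| ≤ A * Λ ^ n * Real.exp (-(δ * L ^ n) * dist a b))
    (hlip : ∀ n b b' a, |D n b a - D n b' a|
      ≤ A * Λ ^ n * M ^ n * sep b b' * Real.exp (-(δ * L ^ n) * min (dist a b) (dist a b')))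
    (N : ℕ) (b b' : β) (a : α) :
    |∑ n ∈ range N, (D n b a - D n b' a)|
      ≤ 2 ^ (1 - θ) * A / (1 - Λ * M ^ θ) * sep b b' ^ θ * Real.exp (-δ * min (dist a b) (dist a b')) := by
  set m := min (dist a b) (dist a b') with hm
  have hm0 : 0 ≤ m := le_min (hd a b) (hd a b')
  have hmb : m ≤ dist a b := min_le_left _ _
  have hmb' : m ≤ dist a b' := min_le_right _ _
  have hsb : 0 ≤ sep b b' := hsep b b'
  have hL0 : 0 ≤ L := zero_le_one.trans hL
  -- the decay factor of the n-th scale is at least as good as that of scale 0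
  have hE : ∀ n : ℕ, Real.exp (-(δ * L ^ n) * m) ≤ Real.exp (-δ * m) := by
    intro n
    apply Real.exp_le_exp.2
    have hLn : (1 : ℝ) ≤ L ^ n := one_le_pow₀ hL
    nlinarith [mul_nonneg hδ hm0]
  -- per term: interpolation between the sup bounds (taken at the common point m) and the Lipschitz bound
  have hterm : ∀ n : ℕ, |D n b a - D n b' a|
      ≤ 2 ^ (1 - θ) * A * (Λ * M ^ θ) ^ n * sep b b' ^ θ * Real.exp (-δ * m) := by
    intro n
    have hδLn : 0 ≤ δ * L ^ n := mul_nonneg hδ (pow_nonneg hL0 n)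
    have hAΛ : 0 ≤ A * Λ ^ n := mul_nonneg hA (pow_nonneg hΛ n)
    have hx : |D n b a| ≤ A * Λ ^ n * Real.exp (-(δ * L ^ n) * m) := by
      refine (hsup n b a).trans (mul_le_mul_of_nonneg_left (Real.exp_le_exp.2 ?_) hAΛ)
      nlinarith
    have hy : |D n b' a| ≤ A * Λ ^ n * Real.exp (-(δ * L ^ n) * m) := by
      refine (hsup n b' a).trans (mul_le_mul_of_nonneg_left (Real.exp_le_exp.2 ?_) hAΛ)
      nlinarith
    have hl : |D n b a - D n b' a| ≤ A * Λ ^ n * M ^ n * sep b b' * Real.exp (-(δ * L ^ n) * m) := hlip n b b' a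
    have h := abs_sub_le_holder hAΛ (pow_nonneg hM n) hsb (Real.exp_pos _).le hθ0 hθ1 hx hy hl
    have hpos : 0 ≤ 2 ^ (1 - θ) * A * (Λ * M ^ θ) ^ n * sep b b' ^ θ := by positivity
    calc |D n b a - D n b' a|
        ≤ 2 ^ (1 - θ) * (A * Λ ^ n) * (M ^ n) ^ θ * sep b b' ^ θ * Real.exp (-(δ * L ^ n) * m) := h
      _ = 2 ^ (1 - θ) * A * (Λ * M ^ θ) ^ n * sep b b' ^ θ * Real.exp (-(δ * L ^ n) * m) := by
          rw [← Real.rpow_pow_comm hM θ n, mul_pow]; ring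
      _ ≤ 2 ^ (1 - θ) * A * (Λ * M ^ θ) ^ n * sep b b' ^ θ * Real.exp (-δ * m) :=
          mul_le_mul_of_nonneg_left (hE n) hpos
  -- the geometric sum in the interpolated factor
  have hq0 : 0 ≤ Λ * M ^ θ := mul_nonneg hΛ (Real.rpow_nonneg hM θ)
  have hgeom : ∑ n ∈ range N, (Λ * M ^ θ) ^ n ≤ 1 / (1 - Λ * M ^ θ) := by
    have h := @geom_sum_Ico_le_of_lt_one ℝ _ _ _ (Λ * M ^ θ) 0 N hq0 hr
    rw [pow_zero] at h
    rwa [Finset.range_eq_Ico]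
  have hC : 0 ≤ 2 ^ (1 - θ) * A * sep b b' ^ θ * Real.exp (-δ * m) := by positivity
  calc |∑ n ∈ range N, (D n b a - D n b' a)| ≤ ∑ n ∈ range N, |D n b a - D n b' a| := Finset.abs_sum_le_sum_abs _ _
    _ ≤ ∑ n ∈ range N, 2 ^ (1 - θ) * A * (Λ * M ^ θ) ^ n * sep b b' ^ θ * Real.exp (-δ * m) :=
        Finset.sum_le_sum fun n _ => hterm n
    _ = 2 ^ (1 - θ) * A * sep b b' ^ θ * Real.exp (-δ * m) * ∑ n ∈ range N, (Λ * M ^ θ) ^ n := by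
        rw [Finset.mul_sum]
        exact Finset.sum_congr rfl fun n _ => by ring
    _ ≤ 2 ^ (1 - θ) * A * sep b b' ^ θ * Real.exp (-δ * m) * (1 / (1 - Λ * M ^ θ)) :=
        mul_le_mul_of_nonneg_left hgeom hC
    _ = 2 ^ (1 - θ) * A / (1 - Λ * M ^ θ) * sep b b' ^ θ * Real.exp (-δ * m) := by ring

/-- **«of order less than 2» is where the mechanism stops.**  If the interpolated factor `r = ΛM^θ` is `≥ 1`, the per-scale majorants
`c·rⁿ` alone sum to at least `N·c` — no bound uniform in the number of scales k comes out of them (print's factors: θ = 1, i.e. two full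
derivatives, gives `r = L^0 = 1`; cf. p. 262 *"Of course there is no uniform bound on ∂C_k"*). [cite: BalabanImbrieJaffe1988, (2.13) p.261] -/
theorem holderMajorant_ge {r c : ℝ} (hr : 1 ≤ r) (hc : 0 ≤ c) (N : ℕ) : (N : ℝ) * c ≤ ∑ n ∈ range N, c * r ^ n := by
  have hterm : ∀ n ∈ range N, c ≤ c * r ^ n := fun n _ =>
    le_mul_of_one_le_right hc (one_le_pow₀ hr)
  calc (N : ℝ) * c = ∑ _n ∈ range N, c := by simp
    _ ≤ ∑ n ∈ range N, c * r ^ n := Finset.sum_le_sum hterm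

/-! ## §3  The operator form in r18's (2.13) vocabulary -/

/-- Row sums for the pair distance `min{dist(a,b), dist(a,b′)}`: at most the two row sums. [cite: BalabanImbrieJaffe1988, (2.13) p.261] -/
theorem sum_exp_min_le [Fintype α] {dist : α → β → ℝ} {c S : ℝ} (hS : ∀ b, ∑ a, Real.exp (-c * dist a b) ≤ S) (b b' : β) :
    ∑ a, Real.exp (-c * min (dist a b) (dist a b')) ≤ 2 * S := by
  have hpt : ∀ a, Real.exp (-c * min (dist a b) (dist a b'))
      ≤ Real.exp (-c * dist a b) + Real.exp (-c * dist a b') := by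
    intro a
    rcases min_choice (dist a b) (dist a b') with h | h <;> rw [h]
    · linarith [Real.exp_pos (-c * dist a b')]
    · linarith [Real.exp_pos (-c * dist a b)]
  calc ∑ a, Real.exp (-c * min (dist a b) (dist a b'))
      ≤ ∑ a, (Real.exp (-c * dist a b) + Real.exp (-c * dist a b')) := Finset.sum_le_sum fun a _ => hpt a
    _ = ∑ a, Real.exp (-c * dist a b) + ∑ a, Real.exp (-c * dist a b') := Finset.sum_add_distrib
    _ ≤ S + S := add_le_add (hS b) (hS b')
    _ = 2 * S := by ring

/-- The difference of `(Kf)` at two output points is the pair-carrier operator with kernel `K(b,·) − K(b′,·)` applied to `f`.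
[cite: BalabanImbrieJaffe1988, (2.13) p.261] -/
theorem applyK_sub_applyK [Fintype α] (K : β → α → ℝ) (f : α → ℝ) (b b' : β) :
    applyK K f b - applyK K f b' = applyK (fun (p : β × β) a => K p.1 a - K p.2 a) f (b, b') := by
  simp only [applyK, ← Finset.sum_sub_distrib, sub_mul]

/-- **(2.13), «similarly for derivatives of 𝒟_{k,loc} and Hölder derivatives of order less than 2» — the operator form, explicit constants.**
Under the per-scale hypotheses of `holderKernel_le`, the row sums `Σ_a e^{−(δ/2)dist(a,b)} ≤ S` and `ΛM^θ < 1`: for all `N`, `f`, `b`, `b′`,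
`|(𝒟f)(b) − (𝒟f)(b′)| ≤ (2^{1−θ}A/(1 − ΛM^θ))·sep(b,b′)^θ·2S·e^{−(δ/2)dist(suppt f,{b,b′})}·‖f‖_∞` (`𝒟 = Σ_{n<N}D_n`; the support distance to the
pair = r18's `suppDist` on the pair carrier with `min{dist(a,b),dist(a,b′)}`) — the Hölder-θ quotient of the bond function `𝒟f` decays like the
function bound (2.13), uniformly in k. [cite: BalabanImbrieJaffe1988, (2.13) p.261] -/
theorem holderOpDecay213 [Fintype α] {D : ℕ → β → α → ℝ} {dist : α → β → ℝ} {sep : β → β → ℝ} {A Λ M L δ θ S : ℝ}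
    (hL : 1 ≤ L) (hΛ : 0 ≤ Λ) (hM : 0 ≤ M) (hA : 0 ≤ A) (hδ : 0 ≤ δ) (hθ0 : 0 ≤ θ) (hθ1 : θ ≤ 1)
    (hr : Λ * M ^ θ < 1) (hd : ∀ a b, 0 ≤ dist a b) (hsep : ∀ b b', 0 ≤ sep b b')
    (hsup : ∀ n b a, |D n b a| ≤ A * Λ ^ n * Real.exp (-(δ * L ^ n) * dist a b))
    (hlip : ∀ n b b' a, |D n b a - D n b' a|
      ≤ A * Λ ^ n * M ^ n * sep b b' * Real.exp (-(δ * L ^ n) * min (dist a b) (dist a b')))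
    (hS : ∀ b, ∑ a, Real.exp (-(δ / 2) * dist a b) ≤ S) (N : ℕ) (f : α → ℝ) (b b' : β) :
    |applyK (fun b a => ∑ n ∈ range N, D n b a) f b - applyK (fun b a => ∑ n ∈ range N, D n b a) f b'|
      ≤ 2 ^ (1 - θ) * A / (1 - Λ * M ^ θ) * sep b b' ^ θ * (2 * S)
        * Real.exp (-(δ / 2) * suppDist (fun a (p : β × β) => min (dist a p.1) (dist a p.2)) f (b, b')) * supNorm f := by
  rw [applyK_sub_applyK]
  have hsb : 0 ≤ sep b b' := hsep b b'
  have h1r : 0 < 1 - Λ * M ^ θ := by linarith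
  have hA' : 0 ≤ 2 ^ (1 - θ) * A / (1 - Λ * M ^ θ) * sep b b' ^ θ := by positivity
  have hK : ∀ a, |(∑ n ∈ range N, D n b a) - ∑ n ∈ range N, D n b' a|
      ≤ 2 ^ (1 - θ) * A / (1 - Λ * M ^ θ) * sep b b' ^ θ * Real.exp (-δ * min (dist a b) (dist a b')) := by
    intro a
    rw [← Finset.sum_sub_distrib]
    exact holderKernel_le hL hΛ hM hA hδ hθ0 hθ1 hr hd hsep hsup hlip N b b' a
  exact abs_applyK_le_of_kernel (dist := fun a (p : β × β) => min (dist a p.1) (dist a p.2))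
    (K := fun (p : β × β) a => (∑ n ∈ range N, D n p.1 a) - ∑ n ∈ range N, D n p.2 a) hA' hδ hK (sum_exp_min_le hS b b') f

/-- **«similarly for derivatives of 𝒟_{k,loc}» — the endpoint θ = 1.**  The lattice derivative of the bond function `𝒟f` across the pair
`(b,b′)` is its difference quotient at separation `sep(b,b′)` (one spacing); with `ΛM < 1` (print: `Λ < 1` with one power of `L` to spare,
`M = L`): `|(𝒟f)(b) − (𝒟f)(b′)| ≤ (A/(1 − ΛM))·sep(b,b′)·2S·e^{−(δ/2)dist(suppt f,{b,b′})}·‖f‖_∞`. [cite: BalabanImbrieJaffe1988, (2.13) p.261] -/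
theorem differenceOpDecay213 [Fintype α] {D : ℕ → β → α → ℝ} {dist : α → β → ℝ} {sep : β → β → ℝ} {A Λ M L δ S : ℝ}
    (hL : 1 ≤ L) (hΛ : 0 ≤ Λ) (hM : 0 ≤ M) (hA : 0 ≤ A) (hδ : 0 ≤ δ) (hr : Λ * M < 1) (hd : ∀ a b, 0 ≤ dist a b)
    (hsep : ∀ b b', 0 ≤ sep b b')
    (hsup : ∀ n b a, |D n b a| ≤ A * Λ ^ n * Real.exp (-(δ * L ^ n) * dist a b))
    (hlip : ∀ n b b' a, |D n b a - D n b' a|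
      ≤ A * Λ ^ n * M ^ n * sep b b' * Real.exp (-(δ * L ^ n) * min (dist a b) (dist a b')))
    (hS : ∀ b, ∑ a, Real.exp (-(δ / 2) * dist a b) ≤ S) (N : ℕ) (f : α → ℝ) (b b' : β) :
    |applyK (fun b a => ∑ n ∈ range N, D n b a) f b - applyK (fun b a => ∑ n ∈ range N, D n b a) f b'|
      ≤ A / (1 - Λ * M) * sep b b' * (2 * S)
        * Real.exp (-(δ / 2) * suppDist (fun a (p : β × β) => min (dist a p.1) (dist a p.2)) f (b, b')) * supNorm f := by
  have hr' : Λ * M ^ (1 : ℝ) < 1 := by rwa [Real.rpow_one]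
  have h := holderOpDecay213 hL hΛ hM hA hδ zero_le_one le_rfl hr' hd hsep hsup hlip hS N f b b'
  simpa only [Real.rpow_one, sub_self, Real.rpow_zero, one_mul] using h

/-- **A family whose sup factors already carry the extra powers** (e.g. the first-derivative kernels of 𝒟_{k,loc}: one factor `M = L` per
scale on top of `Λ`): with `ΛM < 1` the hierarchical sum obeys r18's ONE-LETTER (2.13) `OpDecay dist (Σ_{n<N}D_n) c` for every `c` with
`(A/(1−ΛM))S ≤ c ≤ δ/2` — `BIJ88MultiscaleDecay223.opDecay213_typed` at the scaling factor `ΛM`. [cite: BalabanImbrieJaffe1988, (2.13) p.261] -/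
theorem opDecay213_scaled [Fintype α] {dist : α → β → ℝ} {D : ℕ → β → α → ℝ} {L Λ M δ A S c : ℝ} (hL : 1 ≤ L)
    (hΛ : 0 ≤ Λ) (hM : 0 ≤ M) (hr : Λ * M < 1) (hδ : 0 ≤ δ) (hA : 0 ≤ A) (hd : ∀ a b, 0 ≤ dist a b)
    (hD : ∀ n b a, |D n b a| ≤ A * (Λ * M) ^ n * Real.exp (-(δ * L ^ n) * dist a b))
    (hS : ∀ b, ∑ a, Real.exp (-(δ / 2) * dist a b) ≤ S) (hlow : A / (1 - Λ * M) * S ≤ c) (hhigh : c ≤ δ / 2) (N : ℕ) :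
    OpDecay dist (fun b a => ∑ n ∈ range N, D n b a) c :=
  opDecay213_typed hL (mul_nonneg hΛ hM) hr hδ hA hd hD hS hlow hhigh N


/-! ## §4  The companion sentence «𝒟_{k,loc}(b₁,b₂) = 0 for dist(b₁,b₂) ≧ ½r(e_k)» across scales (v1.1, seat p08 gen 5)

`BIJ88MultiscaleDecay223.vanishes213_typed` takes, for the terms of scale `j < k` rescaled to step `k`, the displayed hypothesis that their
range `L^{j−k}·½r(e_j)` is at most `½r(e_k)`.  That inequality FOLLOWS from the definitions (2.2) `e_k = (L^kε)^{(4−d)/2}e` and (2.3)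
`r(e_k) = |log e_k⁻¹|^r` once `e_k` is small (`log e_k⁻¹ ≥ r(4−d)/2`, implied by the standing «e small» since `e_k ≤ e` for `L^kε ≤ 1`):
`log e_j⁻¹ = log e_k⁻¹ + (k−j)·((4−d)/2)log L` and `(1 + x)^r ≤ e^{rx}`. -/

/-- (2.2): `log e_j⁻¹ = log e_k⁻¹ + (k − j)·((4−d)/2)·log L` for `j ≤ k` — the lower scales have the smaller charges (d ≤ 4).
[cite: BalabanImbrieJaffe1988, (2.2) p.260] -/
theorem log_inv_eK_eq_add {L ε e : ℝ} (hL : 0 < L) (hε : 0 < ε) (he : 0 < e) (d : ℕ) {j k : ℕ} (hjk : j ≤ k) :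
    Real.log (eK L ε e d j)⁻¹ = Real.log (eK L ε e d k)⁻¹ + ((k - j : ℕ) : ℝ) * (((4 - (d : ℝ)) / 2) * Real.log L) := by
  have hlog : ∀ m : ℕ, Real.log (eK L ε e d m)⁻¹ = -(((4 - (d : ℝ)) / 2) * ((m : ℝ) * Real.log L + Real.log ε) + Real.log e) := by
    intro m
    have hLm : 0 < L ^ m := pow_pos hL m
    rw [Real.log_inv, eK, Real.log_mul (by positivity) he.ne', Real.log_rpow (by positivity), Real.log_mul hLm.ne' hε.ne',
      Real.log_pow]
  rw [hlog j, hlog k, Nat.cast_sub hjk]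
  ring

/-- **`r(e_j) ≤ L^{k−j}·r(e_k)` for `j ≤ k`** — the localization length of scale j, converted to the units of scale k, is at most `r(e_k)`,
provided `e_k` is small: `log e_k⁻¹ ≥ r·(4−d)/2` (and `e_k < 1`), `L > 1`, `d ≤ 4`, `r ≥ 0`.  Proof: `r(e_j) = (ℓ + nκ)^r = ℓ^r(1 + nκ/ℓ)^r ≤
ℓ^r e^{rnκ/ℓ} ≤ ℓ^r Lⁿ` with `ℓ = log e_k⁻¹`, `κ = ((4−d)/2)log L`, `n = k − j`, using `rκ ≤ ℓ·log L`. [cite: BalabanImbrieJaffe1988, (2.3) p.260] -/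
theorem rLen_scale_le {L ε e r : ℝ} (hL : 1 < L) (hε : 0 < ε) (he : 0 < e) (hr : 0 ≤ r) {d : ℕ} (hd : d ≤ 4) {j k : ℕ}
    (hjk : j ≤ k) (hℓ : 0 < Real.log (eK L ε e d k)⁻¹) (hsmall : r * ((4 - (d : ℝ)) / 2) ≤ Real.log (eK L ε e d k)⁻¹) :
    rLen r (eK L ε e d j) ≤ L ^ (k - j) * rLen r (eK L ε e d k) := by
  set ℓ := Real.log (eK L ε e d k)⁻¹ with hℓdef
  set κ := ((4 - (d : ℝ)) / 2) * Real.log L with hκ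
  set n : ℕ := k - j with hn
  have hL0 : 0 < L := by linarith
  have hlogL : 0 < Real.log L := Real.log_pos hL
  have hd' : (d : ℝ) ≤ 4 := by exact_mod_cast hd
  have hκ0 : 0 ≤ κ := mul_nonneg (by linarith) hlogL.le
  have hj : Real.log (eK L ε e d j)⁻¹ = ℓ + (n : ℝ) * κ := log_inv_eK_eq_add hL0 hε he d hjk
  have hsum0 : 0 ≤ ℓ + (n : ℝ) * κ := by positivity
  -- r(e_j) = (ℓ + nκ)^r = ℓ^r (1 + nκ/ℓ)^r
  have hx0 : 0 ≤ (n : ℝ) * κ / ℓ := by positivity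
  have hfac : ℓ + (n : ℝ) * κ = ℓ * (1 + (n : ℝ) * κ / ℓ) := by field_simp
  have h1 : rLen r (eK L ε e d j) = ℓ ^ r * (1 + (n : ℝ) * κ / ℓ) ^ r := by
    rw [rLen, hj, abs_of_nonneg hsum0, hfac, Real.mul_rpow hℓ.le (by positivity)]
  have h2 : rLen r (eK L ε e d k) = ℓ ^ r := by
    rw [rLen, ← hℓdef, abs_of_nonneg hℓ.le]
  -- (1 + x)^r ≤ e^{rx} ≤ Lⁿ
  have h3 : (1 + (n : ℝ) * κ / ℓ) ^ r ≤ Real.exp ((n : ℝ) * κ / ℓ) ^ r :=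
    Real.rpow_le_rpow (by positivity) (by linarith [Real.add_one_le_exp ((n : ℝ) * κ / ℓ)]) hr
  have h4 : Real.exp ((n : ℝ) * κ / ℓ) ^ r ≤ L ^ n := by
    rw [← Real.exp_mul]
    have hrk : r * κ ≤ ℓ * Real.log L := by
      have : r * κ = (r * ((4 - (d : ℝ)) / 2)) * Real.log L := by rw [hκ]; ring
      rw [this]
      exact mul_le_mul_of_nonneg_right hsmall hlogL.le
    have hq : r * κ / ℓ ≤ Real.log L := by rw [div_le_iff₀ hℓ]; linarith
    have hexp : (n : ℝ) * κ / ℓ * r ≤ (n : ℝ) * Real.log L := by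
      have e1 : (n : ℝ) * κ / ℓ * r = (n : ℝ) * (r * κ / ℓ) := by ring
      rw [e1]
      exact mul_le_mul_of_nonneg_left hq (Nat.cast_nonneg n)
    calc Real.exp ((n : ℝ) * κ / ℓ * r) ≤ Real.exp ((n : ℝ) * Real.log L) := Real.exp_le_exp.2 hexp
      _ = L ^ n := by rw [← Real.log_pow, Real.exp_log (pow_pos hL0 n)]
  calc rLen r (eK L ε e d j) = ℓ ^ r * (1 + (n : ℝ) * κ / ℓ) ^ r := h1
    _ ≤ ℓ ^ r * L ^ n := mul_le_mul_of_nonneg_left (h3.trans h4) (Real.rpow_nonneg hℓ.le r)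
    _ = L ^ (k - j) * rLen r (eK L ε e d k) := by rw [h2, hn, mul_comm]

/-- A kernel vanishing beyond `R` vanishes beyond every `R′ ≥ R`. [cite: BalabanImbrieJaffe1988, (2.13) p.261] -/
theorem vanishes_mono {dist : α → β → ℝ} {K : α → β → ℝ} {R R' : ℝ} (h : Vanishes dist K R) (hRR' : R ≤ R') :
    Vanishes dist K R' := fun a b hab => h a b (hRR'.trans hab)

/-- **The displayed hypothesis of `BIJ88MultiscaleDecay223.vanishes213_typed` DISCHARGED from (2.2)–(2.3).**  If the term of scale
`j = k − n` of (2.12), rescaled to step k, has range `L^{−n}·½r(e_{k−n})` (its own printed range `½r(e_j)` in its own units; `n ≤ k`), then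
— for `e_k` small as in `rLen_scale_le` — every term, hence `𝒟_{k,loc} = Σ_{n<N}T_n` (`N ≤ k + 1`), vanishes beyond `½r(e_k)`:
`BIJ88Sect2Statements.Vanishes dist 𝒟_{k,loc} (r(e_k)/2)`. [cite: BalabanImbrieJaffe1988, (2.13) p.261] -/
theorem vanishes213_of_scales {dist : α → β → ℝ} {T : ℕ → α → β → ℝ} {L ε e r : ℝ} (hL : 1 < L) (hε : 0 < ε)
    (he : 0 < e) (hr : 0 ≤ r) {d : ℕ} (hd : d ≤ 4) {k N : ℕ} (hN : N ≤ k + 1) (hℓ : 0 < Real.log (eK L ε e d k)⁻¹)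
    (hsmall : r * ((4 - (d : ℝ)) / 2) ≤ Real.log (eK L ε e d k)⁻¹)
    (hT : ∀ n < N, Vanishes dist (T n) ((L ^ n)⁻¹ * rLen r (eK L ε e d (k - n)) / 2)) :
    Vanishes dist (fun b₁ b₂ => ∑ n ∈ range N, T n b₁ b₂) (rLen r (eK L ε e d k) / 2) := by
  refine vanishes213_typed N fun n hn => vanishes_mono (hT n hn) ?_
  have hnk : n ≤ k := by omega
  have hLn : 0 < L ^ n := pow_pos (by linarith) n
  have h := rLen_scale_le hL hε he hr hd (Nat.sub_le k n) hℓ hsmall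
  rw [Nat.sub_sub_self hnk] at h
  -- L^{−n}·r(e_{k−n}) ≤ r(e_k)
  have h' : (L ^ n)⁻¹ * rLen r (eK L ε e d (k - n)) ≤ rLen r (eK L ε e d k) := by
    rw [inv_mul_le_iff₀ hLn]
    exact h
  linarith

end

end Literature.MathematicalPhysics.QuantumFieldTheory.BalabanImbrieJaffe1984to88.BIJ88HolderDecay213
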